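import Mathlib
import HarnessLib
import HarnessLib.Audit
import Summits.KontsevichZagierPeriods.Statement
import HarnessLib.Audit.Status.Attr

/-!
Route: SpectrahedralScissors

# Route SpectrahedralScissors — 29/64 and 8/33 by cut-and-paste — separability probabilities as
Conjecture-1 instances between spectrahedra; crux = the central-symmetry core of the
maximally-mixed-marginal fibre; kernel form closes

X = (Rebit2964 ∧ Qubit833) ∧ SeparabilityKernel ("it suffices to show X"; card
entanglement-29-64-8-33-spectrahedral-scissors;
supersedes my draft route SeparabilityScissors, retired `not-a-thesis` by the D-0027 audit because
its assembly stopped at the sector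
target — here the deciding theorem `closes` reaches the Statement through the enlarged-kernel
target, as in KinematicFormulas). Rebit2964: the 9-dimensional spectrahedron D_ℝ of two-rebit states
(real symmetric
ρ ≽ 0, Tr ρ = 1, affine chart) and its PPT sub-body P_ℝ = {ρ ∈ D_ℝ : ρ^Γ ≽ 0} satisfy [P_ℝ, 64] ~
[D_ℝ, 29] under the moves of the H21
calculus (value equality = the Lovas–Andai theorem P_sep(ℝ) = 29/64, LovasAndai2017 Thm 2).
Qubit833: the 15-dimensional two-qubit body
D_ℂ and its PPT (= separable, Peres–Horodecki) sub-body satisfy [P_ℂ, 33] ~ [D_ℂ, 8] (value equality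
= 8/33, conjectured by Slater
since 2007, PROVED by Huong–Khoi 2024, re-derived via Duistermaat–Heckman by Zhang–Jiang–Xie 2025;
both value equalities are now kernel-checked facts of this tree,
Literature/Probability/RandomMatrix/TwoQubitSeparabilityVolumes*.lean). Both are pairs of
KZ-RATIONAL
representations of the literal §1.1 shape (polynomial PSD inequalities with integer coefficients,
constant integrands) with equal
values, hence literal instances of the summit; SeparabilityKernel = the kernel conjecture of the
calculus with these two relators
adjoined (GPC-strength, stated openly: modulo the instances it is EQUIVALENT to KZKernelConjecture).
The route's reduction: by the reduction criterion (= PPT for qubits) the PPT body is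
D ∩ τD for the LINEAR INVOLUTION τρ = 1⊗Tr₁ρ − ρ, which on each marginal fibre {Tr₁ρ = ρ_B} is the
point reflection through ½·1⊗ρ_B;
by Milz–Strunz/Lovas–Andai invariance (one congruence change of variables) everything transports to
the maximally-mixed-marginal fibre
K = {ρ ≽ 0, Tr₁ρ = 1/2}, where PPT = K ∩ (½·1 − K) is the CENTRAL-SYMMETRY CORE of the 12-dim (resp.
7-dim) spectrahedron K about the
maximally mixed state. The ranked cruxes are the two fibre instances (QubitCore833, RebitCore2964)
and Slater's pointwise defect identity
(DefectPoly, value now proved in the tree, chain open); the transport (Transport) is load-bearing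
support (re-badged rev 4: bookkeeping); `closes : QubitCore833 → RebitCore2964 → Transport →
SeparabilityKernel →
KontsevichZagierPeriods` is proved in the planner's Sketch2.lean / glue.lean (closure_le + the four
move-subset lemmas + the instances).
Lean: `QubitCore833 ∧ RebitCore2964 ∧ Transport ∧ SeparabilityKernel`

## Assembly
DECIDING THEOREM (D-0027 §2.1), PROVED in glue.lean / Sketch2.lean (rc 0, 15 lines): `closes :
QubitCore833 → RebitCore2964 →
Transport → SeparabilityKernel → KontsevichZagierPeriods` — Transport turns the two fibre cores into
the two global relators
([P,64] − [D,29], [P,33] − [D,8] ∈ KZ.relations); `AddSubgroup.closure_le` with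
KZ.domainAddRel/integrandAddRel/changeOfVariablesRel/
newtonLeibnizRel_subset_relations then gives closure(generators of KZ^sep) ≤ KZ.relations;
SeparabilityKernel yields ker eval ≤
relations, and `r.value = r'.value` is `eval ([r] − [r']) = 0` (`KZ.eval_of`), exactly as in
Theorems/KernelFormKernelImpliesStatement.
A prover can copy the proof verbatim. DefectPoly, DefectLogRebit, XStates25, FibreReflection,
SectorOfSummit are not in the implication
chain: they are the engine parts of the foreseen chains and the record of the logical position.

Rationale: WHY THIS LINE. The separability-probability identities are the only rational volume ratios between
explicit spectrahedra in dimension ≥ 9 whose values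
are THEOREMS (LovasAndai2017 Thm 2; HuongKhoi2024, ZhangJiangXie2025 Prop 6.10) after fifteen years
of being "strikingly difficult"
(LovasAndai2017; BengtssonZyczkowski2017 §16.6 still lists 8/33 as unproved), and Conjecture 1 says
each must be a finite dissection-
and-shear between two ℚ-semialgebraic bodies — a statement of solid geometry about entanglement that
nobody has written down. Imported:
quantum information (reduction criterion HorodeckiHorodecki1999 ⇒ PPT-on-the-fibre = central
reflection; Milz–Strunz invariance
MilzStrunz2014/LovasAndai2017 Thm 1 ⇒ one congruence CoV (1⊗L)ρ(1⊗L)* transports the central fibre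
to every fibre, and
`Literature.NumberTheory.Transcendental.KZ.Equivalent.prod` (PROVED, KZProductIdeal) multiplies the
fibre chain by the base), random-
matrix/symplectic volume technology (Życzkowski–Sommers, Duistermaat–Heckman for the partial-trace
moment map, ChristandlEtAl2012,
ZhangJiangXie2025) and Lovas–Andai's defect functions of the operator-norm ball (LovasAndai2017
Lemma 6, Slater2018). What the line adds
to the negatives index (empty) and to prior routes (none touches spectrahedra, PSD cones or quantum
states; KinematicFormulas/SelbergAMGM
treat invariant measures, MatrixModel cards treat the unitarily INVARIANT side = vol D only): a
sharply isolated test where BOTH printed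
proofs of a proved rational period identity fail to be chains for NAMED reasons — the Lovas–Andai
fibration needs the pointwise defect
identity χ̃₂(ε) = ε²(4−ε²)/3 (Slater2018; unproved in print, PROVED in this tree on 2026-08-15 as
`Literature.Probability.RandomMatrix.ZhangJiangXie2025.volume_Ebody_eq` by an elementary
disc-section computation — a VALUE proof, not a chain), and the spectral Duistermaat–Heckman proof
reaches the 12-dim core only as a
measure-zero slice of 15-dim bodies (limit a → 0, ZhangJiangXie2025 §6.2) — while the rebit proof
(LovasAndai2017 pp. 7–11, App. A)
is limit-free and move-by-move inside the rules up to a weight-2 dilogarithm cancellation. STATUS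
(rev 4, badge repair 2026-08-15): every VALUE hypothesis of the line is now a theorem of the tree
(Literature/Probability/RandomMatrix: LovasAndai2017_rebit_separability_probability_holds and
…_rebit_fibre_…_holds = 29/64; ZhangJiangXie2025_qubit_fibre_separability_probability_holds = 8/33
on the fibre, HuongKhoi2024_qubit_separability_probability_holds = 8/33 globally (hub tree);
LovasAndai2017_lemma6_holds; MilzStrunz2014_xState_separability_probability_holds = 2/5;
volume_Ebody_eq = Slater's χ̃₂), so what remains of every item is exactly the CHAIN question
Conjecture 1 asks; the cruxes are the three chain problems (QubitCore833, RebitCore2964,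
DefectPoly), the transport is support.

RANKED CRUXES. #0 SeparabilityKernel (target) — KERNEL FORM OF THE ENLARGED CALCULUS KZ^sep: every
formal ℤ-combination of integral representations with value 0 lies in the subgroup generated by
domain additivity, integrand additivity, change of variables, Newton–Leibniz AND the two
separability relators [P_ℝ,64] − [D_ℝ,29] (dimension 9) and [P_ℂ,33] − [D_ℂ,8] (dimension 15),
written with the same literal bodies as Transport's conclusion. Honest status: KZKernelConjecture ⇒
it trivially (closure is monotone; `example` in Sketch2.lean), and it ∧ (Rebit2964 ∧ Qubit833) ⇒
KZKernelConjecture ⇒ the Statement (`closes`, proved) — so it is GPC-strength; it is filed so that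
the instances are load-bearing in the deciding theorem and KZ^sep ("freshman calculus with the two
separability probabilities as axioms") is on record as a formal object. Not a staffing target for
provers; refuters may attack it only through the summit-strength barriers. (why it might fail:
GPC-strength (the strength barriers bite here and only here): false iff some equal-valued pair of
representations stays underivable even with the two separability relators adjoined — route Neg's
candidates (regularised MZV relations, Gauss-multiplication pairs) are untouched by them.)
[KontsevichZagier2001, LovasAndai2017, HuongKhoi2024]
#2 QubitCore833 (crux) — THE CENTRAL-SYMMETRY CORE, complex (card E4/E6 recast). K = {x ∈ ℝ¹² : ρ(x)
≽ 0}, ρ(x) = [[X, Z],[Z*, ½−X]] with X = [[x0, x2+x3i],[·, x1]], Z = [[x4+x5i, x6+x7i],[x8+x9i,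
x10+x11i]] — the two-qubit states whose second marginal Tr₁ρ = X + (½−X) is maximally mixed; Core =
K ∩ {½·1 − ρ(x) ≽ 0} = K ∩ σK, σ = point reflection through ¼·1 (= the PPT = separable states of the
fibre: ρ^Γ = W(½·1−ρ)W*, FibreReflection). Claim: [Core, 33] ~ [K, 8] (IntegralRep 12, constant
integrands). Value: vol₁₂(Core)/vol₁₂(K) = 8/33 (HuongKhoi2024 Prop = ZhangJiangXie2025 Prop
6.9–6.10 with vol_HS(K) = π⁵/9676800, f(0) = 8π⁵/319334400; equivalently LovasAndai2017 Cor 2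
fibre-independence + the global 8/33); hit-and-run MC of the typed sets 0.2433 ± 0.0018, global
15-dim ratio 0.2409 ± 0.0023 (kit j000513). Two candidate chains: (A) Lovas–Andai fibration at D =
½: Schur CoV Z = X^{1/2}C(½−X)^{1/2} (semialgebraic, Jacobian det(X)²det(½−X)²), unitary
diagonalisation of X (finite/semialgebraic SVD cells), fibre = B ∩ V_εBV_ε⁻¹ with ε² = ratio of the
eigenvalues of X(½−X)⁻¹ — then DefectPoly (rank 4) + a residual 2-dim rational-integrand identity
with rational value (Slater2018 p. 10: 33·2048/51975 = 8·256/1575); (B) spectral: Core is the zero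
fibre of the SU(2) moment map on the U(4)-invariant body E = {0 ≼ ρ ≼ ½·1, Tr ρ = 1}; Weyl CoV +
Duistermaat–Heckman give vol₁₅(E ∩ {|bloch(Tr₁ρ)| ≤ t}) as an explicit ℚ[t]·π⁶ for t < 1/3
(ZhangJiangXie2025 Prop 6.10), and vol₁₂(Core) is its normalised third derivative at t = 0 — a
limit, not a move. [deps: DefectPoly, FibreReflection] [difficulty: XL] (why it might fail: Not by
value (8/33 on the fibre is a theorem of the tree,
ZhangJiangXie2025_qubit_fibre_separability_probability_holds). As a CHAIN: plan (A) needs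
semialgebraic Schur/SVD cells, DefectPoly as a UNIFORM chain (open — its value is now proved, its
chain is not) and every π-factor cancelled side-against-side without evaluation; plan (B) reaches
this 12-dim body only as a null slice of 15-dim bodies (limit t→0 = ZJX §6.2), not a move.)
[HuongKhoi2024, ZhangJiangXie2025, LovasAndai2017, Slater2018, HorodeckiHorodecki1999,
ChristandlEtAl2012]
#3 RebitCore2964 (crux) — THE CENTRAL-SYMMETRY CORE, real (card E3 on the fibre). K_ℝ = {x ∈ ℝ⁷ :
ρ(x) ≽ 0}, ρ(x) = [[X, Z],[Zᵀ, ½−X]], X = [[x0,x2],[x2,x1]], Z = [[x3,x4],[x5,x6]] (two-rebit states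
with maximally mixed second marginal); Core_ℝ = K_ℝ ∩ {½·1 − ρ ≽ 0}. Claim: [Core_ℝ, 64] ~ [K_ℝ, 29]
(IntegralRep 7). Value: LovasAndai2017 Thm 2 (29/64) with Cor 2 (the conditional PPT probability is
independent of the marginal D; Thm 2 is computed FROM the fibre formula eq. (psep)); hit-and-run MC
of the typed sets 0.4530 ± 0.0021, and 0.4528 ± 0.0021 on the fibre over D = diag(.7,.3), global
9-dim ratio 0.4526 ± 0.0020 (kit j000513). Foreseen chain = LA's proof made semialgebraic (≈ 30
moves): Schur CoV Z = X^{1/2}C(½−X)^{1/2} (Jacobian det X·det(½−X)); rotation cells diagonalising X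
(tan-half-angle chart, Jacobian |ξ₁−ξ₂|, the angular factor [ℝ, 2/(1+t²)] carried as a spectator on
BOTH sides, never integrated out); fibre = B_ℝ ∩ V_εB_ℝV_ε⁻¹ handled by DefectLogRebit (LA Lemma 6
as a uniform chain, App. A: in the chart (r, w = e^t, ρ, tan φ/2) the conjugation is the scaling w ↦
εw and the volume form is r³); LA p. 8: u = (1−x)/(1+x), (u,v) ↦ (ts, s/t) (rule 2), one integration
by parts (rules 1+3, rational primitive), Fubini is free; final step: LA's closing identity
(64/3)∫₀¹ R(t)·χ̃₁′(t) dt = 1/4 (p. 8) with R(t) = (11(1−t⁶)+27t²(1−t²)+6(1+t²)(1+8t²+t⁴)log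
t)/(t²−1)⁷ and χ̃₁′(t) = (4/π²)(t+1/t−½(t−1/t)²log((1+t)/(1−t)))/t, i.e. a 3-dim rational
representation (both logs unfolded: log t = −∫_t^1 du/u, log((1+t)/(1−t)) = ∫₀^t 2du/(1−u²))
KZ-equivalent to (3/256)·[π]⋆[π] — LA exhibit the primitive (Li₂(1−t), Li₂(−t), log t·log(1+t),
atanh; p. 8), so only Li₂(1) = π²/6-type evaluations remain, which have classical algebraic-CoV
chains (Calabi: ∫∫_{pq<1} dp dq/((1+p²)(1+q²)) = π²/8 via the involution (p,q) ↦ (1/p,1/q)). [deps: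
DefectLogRebit, FibreReflection] [difficulty: L] (why it might fail: Value proved, also in the tree
(LovasAndai2017_rebit_fibre_separability_probability_holds). Chain risk: LA's closing primitive
(Li₂(1−t), Li₂(−t), log·log, p. 8) is not semialgebraic (barrier
noSemialgebraicPrimitive_inv_sub_two), so both logs must ride as extra variables and the weight-2
cancellation to (3/256)π² be redone by moves; plus SVD/rotation cells off null sets.)
[LovasAndai2017, Slater2018, KontsevichZagier2001]
#4 DefectPoly (crux) — SLATER'S DEFECT IDENTITY as a uniform family of 8-dim instances (card E4). B
= operator-norm unit ball of ℂ^{2×2} in real coordinates z ∈ ℝ⁸ (M = [[z0+z1i, z2+z3i],[z4+z5i,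
z6+z7i]]; ‖M‖ ≤ 1 ⟺ Tr M*M ≤ 2 ∧ det(1 − M*M) = 1 − Σz² + |det M|² ≥ 0 — polynomial), and for
rational ε ∈ (0,1] the conjugate condition ‖V_ε⁻¹MV_ε‖ ≤ 1, V_ε = diag(1, ε) (entries b ↦ εb, c ↦
c/ε; written ×ε² as polynomials). Claim: [B ∩ V_εBV_ε⁻¹, 3] ~ [B, ε²(4−ε²)] for every rational 0 < ε
≤ 1, i.e. Lovas–Andai's χ̃₂(ε) = ε²(4−ε²)/3 with a rules-proof uniform in ε (parameter-as-variable: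
d/dε of the moving wall as Newton–Leibniz in ε with a semialgebraic primitive — polynomiality of a
period function is the one case where a rules-proof is easier than an analytic one). Under it, plan
(A) of QubitCore833 has no transcendental step at all. Value status: THEOREM of the tree since
2026-08-15 (in print only conjectural: Slater2018 eq. (VerifiedFormula), CAD on an 11-dim subfamily
+ the 8/33 sum rule): `ZhangJiangXie2025.volume_Ebody_eq`
(TwoQubitSeparabilityVolumesQubitFibreProofs.lean) gives vol₈(B ∩ V_qBV_q⁻¹) = (π⁴/36)ε²(4−ε²) with
ε² = min(q², q⁻²) for every real q > 0, and vol₈(B) = π⁴/12 (the body `Ebody q` there is literally B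
∩ B_{diag(q)} with the conjugation (a, qb, c/q, d) = this item's V_ε convention; its ball condition
'column norms ≤ 1 ∧ det(1−M*M) ≥ 0' and this item's 'Tr M*M ≤ 2 ∧ det(1−M*M) ≥ 0' are the same
closed operator-norm ball). Proof there: for fixed (b, c, d) the admissible a form a DISC,
concentric for B and B_q (bc is invariant), three radial integrations, and a 2-dim integral of
min((1−σ)(1−τ), (1−q²σ)(1−τ/q²)) = ε²(4−ε²)/12 — a value computation, not a chain (each disc is
integrated to π). Planner MC (kit j000373): χ̃₂(0.5) = 0.3160±0.0015 vs 5/16 = 0.3125 (z = +2.4, now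
known to be a fluctuation), χ̃₂(0.7) = 0.5721±0.0016 (0.5733), χ̃₂(0.3) = 0.1161±0.0010 (0.1173).
[difficulty: L] (why it might fail: No longer by value. What can fail is the UNIFORM chain in
rational ε: the disc-fibre centres −d̄bc/(1−|d|²) and radii are algebraic (√) functions, the
min-cell split along the semialgebraic wall is a rule-1 dissection, but the three π's of the value
proof must cancel side-against-side without ever being evaluated; a forced evaluation anywhere means
no chain of this shape.) [Slater2018, LovasAndai2017]
#5 Transport (support since rev 4 — was a crux; re-badged because it fails the crux test:
bookkeeping, no source bears on its falsity; it stays a load-bearing hypothesis of `closes`, rank 5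
kept for ordering) — MILZ–STRUNZ INVARIANCE AS A CHAIN (card E5): the two fibre instances imply the
two GLOBAL Conjecture-1 instances Rebit2964 ∧ Qubit833 — [P_ℝ, 64] ~ [D_ℝ, 29] in dimension 9
(coordinates y: X = [[y0,y2],[y2,y1]], Y = [[y3,y4],[y4,1−y0−y1−y3]], Z = [[y5,y6],[y7,y8]], ρ =
[[X,Z],[Zᵀ,Y]], ρ^Γ = [[X,Zᵀ],[Z,Y]]) and [P_ℂ, 33] ~ [D_ℂ, 8] in dimension 15 (X = [[y0,
y2+y3i],[·,y1]], Y = [[y4, y5+y6i],[·, 1−y0−y1−y4]], Z = [[y7+y8i, y9+y10i],[y11+y12i, y13+y14i]], ρ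
= [[X,Z],[Z*,Y]], ρ^Γ = [[X,Z*],[Z,Y]] = partial transpose on the first factor; domains = PSD sets,
integrands the constants; values 64·vol P_ℝ = 29·vol D_ℝ, LovasAndai2017 Thm 2, and 33·vol P_ℂ =
8·vol D_ℂ, HuongKhoi2024; hit-and-run MC of exactly these sets, kit j000513: global 0.2409±0.0023
and 0.4526±0.0020). Mechanism: the local filtering (1⊗L)ρ₀(1⊗L)*, L = Cholesky factor of 2ρ_B over
the open Bloch ball (semialgebraic section), maps base × K bijectively onto the faithful-marginal
part of D (complement null), is linear in ρ₀ with fibre Jacobian |det L|^{12} = det(2ρ_B)⁶ (complex;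
|det L|⁷ = det(2ρ_B)^{7/2} real — LovasAndai2017 Thm 1 exponents 4d − d²/2), preserves ≽ 0 and
commutes with Γ on the first factor, so ONE change of variables (rule 2) turns [P, 33] into [base ×
Core, 33·J(m)] = [base, J]⋆[Core, 33] and [D, 8] into [base, J]⋆[K, 8]; `KZ.Equivalent.prod`
(proved, Literature KZProductIdeal) multiplies the fibre chain by [base, J]. No averaging, no
singular-value reduction, no χ-function is needed for this step. [deps: QubitCore833, RebitCore2964]
[difficulty: M] (labour, not risk: a ℚ-semialgebraic Cholesky section over the open Bloch ball,
InjOn/HasFDerivWithinAt of (m,x) ↦ (1⊗L(m))ρ₀(x)(1⊗L(m))* on a full-measure cell, its 15×15 Jacobian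
= det(2m)⁶·(base factor) in Lean, null set of singular marginals disposed of by rule 1a; the
measure-theoretic shadow of exactly this transport is PROVED in the tree —
`LovasAndai2017.rebit_volume_eq_const_mul_fibre_volume`
(TwoQubitSeparabilityVolumesRebitFullProofs.lean: the congruence, its common Jacobian on both
bodies, Fubini over the marginal) and `HuongKhoi2024.fibre_volume_transport` /
`measurePreserving_fibreChart` (TwoQubitSeparabilityVolumesProofs.lean, hub tree) — and can be mined
for the section, the Jacobian and the null set.) [MilzStrunz2014, LovasAndai2017,
KontsevichZagier2001]
#9 FibreReflection (support) — PPT = CENTRAL REFLECTION ON THE FIBRE (Huong–Khoi's spectral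
criterion = the reduction criterion of HorodeckiHorodecki1999 for qubits): for the real 7-dim and
complex 12-dim fibre parametrisations, ρ(x)^Γ ≽ 0 ↔ ½·1 − ρ(x) ≽ 0, because ρ^Γ = (DS)(½·1 − ρ)(DS)ᵀ
with S the block swap and D = diag(1,1,−1,−1) (uses only X + Y = ½·1). Three-line matrix identity +
`Matrix.PosSemidef` congruence lemmas; links the cores of QubitCore833/RebitCore2964 to the literal
PPT bodies of Target (needed inside Transport). [difficulty: provable-now] [HorodeckiHorodecki1999,
HuongKhoi2024, ZhangJiangXie2025]
#9 SectorOfSummit (support) — LOGICAL POSITION, both directions: (a) KZKernelConjecture →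
SeparabilityKernel (closure monotone; the target is summit-strength, not weaker); (b)
KontsevichZagierPeriods → (64·vol P_ℝ = 29·vol D_ℝ, as value equality of the typed 9-dim
representations) → (33·vol P_ℂ = 8·vol D_ℂ, dimension 15) → Rebit2964 ∧ Qubit833 (constant
integrands are IsRational with p = C a, q = 1), so each instance and each fibre core is a NECESSARY
condition of the summit: a genuine non-derivability proof refutes the summit. Value hypotheses =
LovasAndai2017 Thm 2, HuongKhoi2024 — landed as named facts
`LovasAndai2017_rebit_separability_probability`, `HuongKhoi2024_qubit_separability_probability`
(Literature/Probability/RandomMatrix/TwoQubitSeparabilityVolumes.lean, charts verbatim this route's)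
and DISCHARGED (`…_holds`, TwoQubitSeparabilityVolumesRebitHolds.lean /
TwoQubitSeparabilityVolumesProofs.lean); the KZ-value form of (b)'s complex hypothesis is
`HuongKhoi2024_qubit_separability_probability.kz_value_eq` (TwoQubitSeparabilityVolumesKZ.lean);
since rev 3 the kernel conjecture in (a) is written unfolded (no @[conjecture] leaf in the cone).
[difficulty: provable-now] [KontsevichZagier2001, LovasAndai2017, HuongKhoi2024]
#9 DefectLogRebit (support) — LOVAS–ANDAI LEMMA 6 AS A UNIFORM CHAIN (first brick of RebitCore2964):
for rational 0 < ε ≤ 1, [B_ℝ ∩ V_εB_ℝV_ε⁻¹, 3] (IntegralRep 4; B_ℝ = {z : Σz² ≤ 2, 1 − Σz² + (z0z3 −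
z1z2)² ≥ 0} the operator-norm ball of ℝ^{2×2}) ~ the 2-dim rational representation [{0 < t < s < ε},
8((s²+1)/s³ − (s²−1)²/(s³(1−t²)))] (log((1+s)/(1−s)) unfolded as ∫₀^s 2dt/(1−t²)); value 3χ₁(ε) =
8∫₀^ε (s + 1/s − ½(s−1/s)² log((1+s)/(1−s))) ds/s (χ₁(1) = 2π²/3; LovasAndai2017 Lemma 6 + Table 2,
PROVED there, App. A, and in the tree: `LovasAndai2017_lemma6_holds`, `LovasAndaiLemma6.lean`, whose
Part A is LA's App. A atlas made measure-theoretic — the same cell split at t = δ/2 this chain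
needs; planner MC χ̃₁(0.5) = 0.5312 ± 0.0004 = Simpson of Lemma 6, kit j000373). Chain: LA's App. A
atlas X = rY±(t,ρ,φ) with w = e^t, u = tan(φ/2) is semialgebraic, the similarity by Λ_δ is the
scaling w ↦ e^{−δ}w, √det g = r³ (NL in r, primitive r⁴/4), the comparison ‖Y(t−δ)‖ > ‖Y(t)‖ ⟺ t <
δ/2 is a semialgebraic cell split, and the (ρ,φ)-integrals of p. 15 have rational primitives up to
the one log kept as a variable. [difficulty: M] [LovasAndai2017, Slater2018]
#9 XStates25 (support) — X-STATES CALIBRATION (toy rung, provable now): two-qubit X-states ρ =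
[[a,0,0,w],[0,b,z,0],[0,z̄,c,0],[w̄,0,0,d]], a+b+c+d = 1, form the 7-dim body D_X = {a,b,c,d ≥ 0,
|w|² ≤ ad, |z|² ≤ bc}; PPT_X = D_X ∩ {|w|² ≤ bc, |z|² ≤ ad}. Claim [PPT_X, 5] ~ [D_X, 2]
(Milz–Strunz 2015 / Dunkl–Slater 2015: HS separability probability of X-states = 2/5, reproduced in
Slater2018; PROVED in the tree on exactly these two typed bodies:
`MilzStrunz2014_xState_separability_probability_holds`, MilzStrunzXStatesProofs.lean, by the same
disc-fibre / ad = bc split this chain prescribes; planner check E[min(ad,bc)²]/E[abcd] = 0.40003,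
kit j000504). Chain: disc fibres w = √(ad)·u (rule 2, Jacobian ad) make both sides [Δ-cells,
polynomial]⋆[disc]⋆[disc]; split Δ along ad = bc (c = a(1−a−b)/(a+b), rational); iterated
Newton–Leibniz with polynomial/rational primitives down to dimension 0 on each side (values 2/5040
both) and back. Exercises exactly the disc-fibre/product/min-cell bookkeeping of the big bodies.
[difficulty: provable-now] [Slater2018, MilzStrunz2014]

TWO-LAYER PLAN. Foreseen glued splits (k ≤ 3, depth 1), filed only after a crux closes or stalls
with a census:
QubitCore833 ⇐ FibreOverX (LA Thm 1 at D = ½ as a chain: Schur CoV + SVD cells, [Core,33] ~ [X-body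
× B-fibres, 33·det(X)²det(½−X)²·1_{conj}])
→ DefectPoly → SumRule833 (the residual 2-dim rational-integrand identity with rational value,
Slater2018 p. 10 numbers 2048/51975 and
256/1575) ; RebitCore2964 ⇐ DefectLogRebit → RebitIBP (LA p. 8 substitutions + IBP as moves, output
a 3-dim rational rep) →
DilogCancellation (that rep ~ (3/256)·[π]⋆[π]: weight-2 Euler-sum chain); Transport ⇐
CholeskySection (semialgebraic section + null set)
→ CongruenceJacobian (rule-2 instance with |det| = det(2m)⁶ resp. det(2m)^{7/2}) → Transport via
`KZ.Equivalent.prod`.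

KILL CRITERIA. Every item now has a CERTIFIED value side, kernel-checked in this tree for all but
the SpectralShellDH shells (29/64 global and fibre, 8/33 global and fibre, Lemma 6, χ̃₂ =
ε²(4−ε²)/3, 2/5; FibreReflection is linear algebra): a genuine non-derivability proof of a Transport
conjunct (Rebit2964/Qubit833), QubitCore833, RebitCore2964, DefectPoly, DefectLogRebit or
XStates25 refutes the SUMMIT; ¬SeparabilityKernel likewise (it is implied by KZKernelConjecture,
SectorOfSummit (a)) — report to the operator, close `refuted:<Decl>`, hand the witness to route Neg.
A refutation merely "as
typed" (values differ because a block/conjugation/coordinate convention slipped — guarded by the kit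
jobs j000373/j000504/j000513) forces a
1:1 `--restate`, never a pivot. DefectPoly can no longer die by value (Slater's formula is a theorem
of the tree); if its UNIFORM chain STALLS (harness-declared exhaustion with a census naming the step
where a π must be evaluated), that is not a route kill either: it is not in `closes`; re-plan
QubitCore833 along the spectral line (B) (SpectralShellDH) together with the structural routes on
specialisation of uniform chains (StandardParts,
ValuedFieldSpecialisation, card limit-is-a-move) — that outcome is itself the route's most
informative possible finding ("8/33 has no
limit-free chain along either printed proof"). The route is MOOTED if KZKernelConjecture is proved
(everything follows) and SHORTENED if a general
"Duistermaat–Heckman push-forward under an algebraic moment map is a chain" theorem (card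
bending-flows-dh-is-a-move) or MultivaluedCoV's
sheet-transfer lands first.

NOT DECOMPOSED YET. The spectral line (B) as typed items — the 15-dim shell identities vol(E ∩ {|b|
≤ t}) = explicit ℚ[t]·π⁶ for rational t < 1/3
(ZhangJiangXie2025 Prop 6.10; non-abelian DH for the partial trace as moves) are filed INFORMALLY
right after open (rank 6,
SpectralShellDH) until the HS/Lebesgue/symplectic normalisation constants are certified by a kit
job; the quaternionic 26/323 (27-dim,
value conjectural, Slater2018); the operator-monotone √x measure companion (LovasAndai2017 Thm 4:
only the numerical value 0.26223 with
complete elliptic K, E in the integrand — no closed form, mixed weight; not filed); qubit–qutrit;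
the general finite-averaging lemma and
the general DH-is-a-chain statement (belong to cards integral-geometry-kinematic-formulas-compile
and bending-flows-dh-is-a-move); the
sub-lemmas of Transport (Cholesky semialgebraicity, Jacobian) — layer-2 children later; Literature
facts LovasAndai 29/64 and Huong–Khoi
8/33: landed as named `def`s AND discharged (TwoQubitSeparabilityVolumes*.lean; no statement of this
route imports them — values enter only SectorOfSummit as
explicit hypotheses, so the route's cone has 0 unproved facts).

CHEAPEST FALSIFIER. Run first, cheapest first: (i) the typed sets themselves — hit-and-run uniform
sampling with exact PSD chords (planner folder
num/hitrun.py, kit j000513): complex fibre core fraction 0.2433 ± 0.0018 (8/33 = 0.2424), real fibre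
0.4530 ± 0.0021 (29/64 = 0.4531), global 15-dim 0.2409 ± 0.0023, global 9-dim 0.4526 ± 0.0020, real
fibre over D = diag(.7,.3) 0.4528 ± 0.0021 (invariance);
box-rejection MC is BIASED here (off-diagonal entries reach 1/2; a ±1/4 box gave 0.48 for the real
fibre — kit j000373/j000504, do not
repeat that mistake); (ii) SETTLED: DefectPoly at ε = 1/2 is TRUE by value (χ̃₂(1/2) = 5/16,
`ZhangJiangXie2025.volume_Ebody_eq`; the planner MC 0.3160 ± 0.0015, z = +2.4, kit j000373, was a
fluctuation) — the cheapest remaining research falsifier is to run the provable-now rungs XStates25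
and DefectLogRebit as ACTUAL finite chains: if already there the disc areas / the single log cannot
be matched side-against-side without evaluating a π, plan (A)'s mechanics are dead before any 12-dim
work;
(iii) the lookup that would kill the NOVELTY: a dissection/bijective or "integration-free" proof of
8/33 or 29/64 already in print —
searched (see Novelty): none; HuongKhoi2024 itself is paywalled (lit want filed; ZhangJiangXie2025
READ reports its method: spectral
criterion + DH + limit).

NUMBERS. vol_HS(K) = π⁵/9676800 and Lebesgue vol₁₂(K) = π⁵/(9676800·128) in the typed chart (MC
2.466e−7 vs 2.4706e−7, kit j000373);
f(a) = π⁵/319334400·(1−a)⁹(33a³+162a²+72a+8) on (0,1/3), f(0)/vol_HS(K) = 8/33 (ZhangJiangXie2025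
Prop 6.7, 6.10); 29/64 =
(16/35 − 1/4)/(16/35) (LovasAndai2017 p. 8); χ₁(1) = vol₄(B_ℝ) = 2π²/3 (MC 6.576), vol₈(B_ℂ) = π⁴/12
in dRe·dIm coordinates (MC 8.10;
LA's λ₈ gives π⁴/6); χ̃₁(0.5) = 0.5312; Slater: χ̃₂(ε) = ε²(4−ε²)/3 (THEOREM in tree: vol₈(B ∩
V_εBV_ε⁻¹) = (π⁴/36)ε²(4−ε²)), numerator 2048/51975, denominator 256/1575; tree values vol₁₂(K) =
π⁵/1238630400 (= π⁵/(9676800·128) ✓), vol₁₂(Core) = π⁵/5109350400 (`volume_Kset_value`,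
`volume_K'set_value`), 33/5109350400 = 8/1238630400; X-states 2/5
(rebit X-states 16/(3π²), quaterbit 2/7); items at open: 10 typed (1 target = enlarged kernel, 1
assembly = type of `closes`, 4 cruxes, 4 support)
+ 1 informal crux (rank 6, SpectralShellDH) and 2 cite-facts filed right after open; items at rev 4:
11 typed = 1 target, 1 assembly, 3 cruxes (QubitCore833 2, RebitCore2964 3, DefectPoly 4), 6 support
(Transport 5, SpectralShellDH 6; FibreReflection, SectorOfSummit, DefectLogRebit, XStates25 9);
cone: 0 unproved facts.

DEFINITION REQUESTS. None blocking (bodies typed inline over `Matrix.PosSemidef`; complex PSD uses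
the term-level `open scoped ComplexOrder in`). Cite facts
wanted (filed after open): LovasAndai2017 Thm 2 and HuongKhoi2024 main theorem as named facts for
the typed 9- /15-dim bodies —
hypotheses of SectorOfSummit (b) only; both LANDED and DISCHARGED (see STATUS above). Optional
later: a `TwoQubitState`/partial-transpose vocabulary under …/Theorems to shorten literals.

Novelty: Searches (2026-08-15): `lit search "two-qubit Hilbert-Schmidt separability probability 8/33 proof
Lovas Andai"` (45 rows: found
HuongKhoi2024 = doi:10.1088/1751-8121/ad8493 — the 2024 PROOF of 8/33, unknown to the card — and 30+
Slater papers; none mentions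
periods, Kontsevich–Zagier, dissections or motives); `lit search --source arxiv "Huong Khoi
separability probability two-qubit"` (1:
ZhangJiangXie2025 = arXiv:2507.02369, READ: DH re-derivation); `lit read arxiv:1610.01410`
(LovasAndai2017 READ in full: Thm 1, Cor 1–2,
Thm 2, Lemma 6, App. A–B); `lit read arxiv:1701.01973 --grep` (Slater2018 READ pp. 3, 9–11: CAD
derivation of χ̃₂ on the 11-dim
subfamily, X-states 16/(3π²), 2/5, 2/7); `lit search --hybrid "reduction criterion separability two
qubits partial transpose"`
(10 held books; BengtssonZyczkowski2017 READ pp. 454, 457–458, 464: reduction map Φ_R(σ) = Tr σ·1 −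
σ, "cannot be stronger than PPT",
and "p₂ = 8/33 … has not been rigorously proven so far"); `lit galaxy search "separability
probability" --star all` (2: a biography
dictionary and Slater arXiv:1605.06459); `lit galaxy search "Duistermaat-Heckman measure separable"
--star all` (0); `lit frontier
KontsevichZagierPeriods --since 2020` (30 rows, none on quantum-state volumes); `lit bridges
KontsevichZagierPeriods --cross any` (30
rows, none); `ledger idea list` (123 cards of the sub-problem: only this card mentions
qubits/spectrahedra; related engines
hciz-compiles-gelfand-tsetlin-plus-lw, matrix-model-couplings-  [refs: 10.1088/1751-8121/ad8493, 10.1088/1751-8121/aa7176, 10.1007/s11128-018-1854-5, 2507.02369, 1610.01410, 1701.01973, 1605.06459, doi:10.1088/1751-8121/ad8493, arxiv:1610.01410, arxiv:1701.01973, doi:10.1088/1751-8121/aa7176, doi:10.1007/s11128-018-1854-5, HuongKhoi2024, ZhangJiangXie2025, LovasAndai2017, Slater2018, BengtssonZyczkowski2017, HorodeckiHorodecki1999]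

Barriers (technique_class: instance-compilation, spectrahedra, parametric-NL, DH): - technique_class: instance-compilation, spectrahedra, parametric-NL, DH
- Literature.Barriers.KontsevichZagierPeriods.noSemialgebraicPrimitive_inv_sub_two: ENGAGED on the
rebit line (RebitCore2964, DefectLogRebit): LA's primitives contain log((1+s)/(1−s)), Li₂(1−t),
Li₂(−t), log t·log(1+t) — none semialgebraic, so rule 3 cannot use them; evaded the standard way
(add variables: every log/dilog is carried as an extra integration variable with a RATIONAL
integrand, and only rational/polynomial primitives are ever used — exactly the barrier's own listed
evasion "add variables"); NOT engaged on the qubit line if DefectPoly holds (polynomial defect ⇒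
polynomial primitives only), and the angular 2/(1+t²) factors of rotation cells are carried as
spectators on both sides, never integrated out.
- Literature.Barriers.KontsevichZagierPeriods.cressonViuSos_prop_3_2: respected, not engaged — every
foreseen chain dissects first (Schur/SVD cells, the ad = bc split, sign cells, null sets of singular
marginals) and no global scissors-free semialgebraic map P → D is claimed (none can exist
equivariantly: P and D have different symmetry); the bodies are spectrahedra, not polyhedra, and of
dimension ≤ 15 where the Hauptvermutung hypothesis is anyway not met by convex bodies.
- Literature.Barriers.KontsevichZagierPeriods.kzConjecture_implies_oddZetaAlgIndep: not engaged —
single instances with proved (29/64, 8/33, 2/5, Lemma 6) or explicitly conjectural (DefectPoly)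
value hypotheses assert no alg

Novelty grade: new-combination — ROUTE REVIEW gen-2 (rreview-0815T13-18-g2-0; full text ROUTE3_REVIEW.md in my folder). KEEP OPEN; not a recombination (conforming re-filing of retired SeparabilityScissors; bodies 9264-9271 = audited 8488-8495). W3.lean rc0 by import, 9/9 typed + `closes` sorry-free std axioms; Assembly := closes. I (refuter refuter-rreview-0815T13-18-g2-0, 2026-08-15T15:10:24Z; prior: LovasAndai2017 arXiv:1610.01410, HuongKhoi2024 doi:10.1088/1751-8121/ad8493, ZhangJiangXie2025 arXiv:2507.02369, Slater2018 arXiv:1701.01973, MilzStrunz2014, KontsevichZagier2001, route-KontsevichZagierPeriods-ScissorsTransport (StableSetTransport), route-KontsevichZagierPeriods-KinematicFormulas (kernel-target pattern))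

History (route lifecycle, newest last):
- 2026-08-15T14:03:48Z · rev 1: dropped SpectralShellDH — drop the informal placeholder stmt-KontsevichZagierPeriods-9598 whose text was lost ('MISSING'); not load-bearing (informal, not in closes); re-filed at once wi (planner-plancard-KontsevichZagierPeriods-Kont-a2532eab-0)
- 2026-08-15T14:13:08Z · rev 2: dropped stmt-KontsevichZagierPeriods-9598 — drop placeholder item stmt-KontsevichZagierPeriods-9598 (informal text lost, reads 'MISSING'); superseded by stmt-KontsevichZagierPeriods-9682 = SpectralShellDH (planner-plancard-KontsevichZagierPeriods-Kont-a2532eab-0)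
- 2026-08-15T16:38:00Z · rev 3: restated SectorOfSummit (stmt-KontsevichZagierPeriods-9269), SpectralShellDH (stmt-KontsevichZagierPeriods-9682) — route-repair (cone guardrail, gen 2): (1) SectorOfSummit restated with KZKernelConjecture unfolded to its body — removes the only undeclared-conjecture leaf fro (planner-rrepair-KontsevichZagierPeriods-Spectr-f4f2bcb1-g2-0)
- 2026-08-16T02:18:25Z · AUTO-CRUX: 1 conjecture-grade item(s) promoted to crux (SpectralShellDH) — refuter vetting / tiering apply (operator:999:1362873)
- 2026-08-16T04:09:37Z · AUTO-CRUX (backfill): SeparabilityKernel — hypotheses of the deciding theorem that nothing in the route derives are cruxes (operator:999:1085951)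

sub-problem: KontsevichZagierPeriods · status: open · opened planner-plancard-KontsevichZagierPeriods-Kont-a2532eab-0 2026-08-15T13:54:51Z · rev 5 · ledger route-KontsevichZagierPeriods-SpectrahedralScissors
GENERATED by the gate from the ledger (D-0016/17). Provers cite these decls: `theorem foo : Summit.KontsevichZagierPeriods.KontsevichZagierPeriods.Theses.SpectrahedralScissors.<Decl> := …` in Summits/KontsevichZagierPeriods/KontsevichZagierPeriods/Theorems/<Name>.lean.
-/

namespace Summit.KontsevichZagierPeriods.KontsevichZagierPeriods.Theses.SpectrahedralScissors

open scoped BigOperators Topology Manifold Classical MeasureTheory ProbabilityTheory Matrix InnerProductSpace ComplexConjugate ContinuousMap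
open Filter Set Function TopologicalSpace MeasureTheory

attribute [summit_statement] _root_.KontsevichZagierPeriods

open Literature Periods

/-- item stmt-KontsevichZagierPeriods-9263 · crux (kind.auto-crux: conjecture-grade) · rank 0 · open · by planner
why it might fail: GPC-strength (the strength barriers bite here and only here): false iff some equal-valued pair of representations stays underivable even with the two separability relators adjoined — route Neg's candidates (regularised MZV relations, Gauss-multiplication pairs) are untouched by them.
sources: KontsevichZagier2001, LovasAndai2017, HuongKhoi2024
[target] KERNEL FORM OF THE ENLARGED CALCULUS KZ^sep: every formal ℤ-combination of integral
representations with value 0 lies in the subgroup generated by domain additivity, integrand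
additivity, change of variables, Newton–Leibniz AND the two separability relators [P_ℝ,64] −
[D_ℝ,29] (dimension 9) and [P_ℂ,33] − [D_ℂ,8] (dimension 15), written with the same literal bodies
as Transport's conclusion. Honest status: KZKernelConjecture ⇒ it trivially (closure is monotone;
`example` in Sketch2.lean), and it ∧ (Rebit2964 ∧ Qubit833) ⇒ KZKernelConjecture ⇒ the Statement
(`closes`, proved) — so it is GPC-strength; it is filed so that the instances are load-bearing in
the deciding theorem and KZ^sep ("freshman calculus with the two separability probabilities as
axioms") is on record as a formal object. Not a staffing target for provers; refuters may attack it
only through the summit-strength barriers. -/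
@[route_item "route-KontsevichZagierPeriods-SpectrahedralScissors", crux]
def SeparabilityKernel : Prop :=
  open scoped ComplexOrder in ∀ c : Literature.NumberTheory.Transcendental.KZ.FormalRep, Literature.NumberTheory.Transcendental.KZ.eval c = 0 → c ∈ AddSubgroup.closure (Literature.NumberTheory.Transcendental.KZ.domainAddRel ∪ Literature.NumberTheory.Transcendental.KZ.integrandAddRel ∪ Literature.NumberTheory.Transcendental.KZ.changeOfVariablesRel ∪ Literature.NumberTheory.Transcendental.KZ.newtonLeibnizRel ∪ ({c | ∃ (ρ ρ' : (Fin 9 → ℝ) → Matrix (Fin 4) (Fin 4) ℝ) (r r' : Literature.NumberTheory.Transcendental.KZ.IntegralRep 9), (∀ y, ρ y = !![y 0, y 2, y 5, y 6; y 2, y 1, y 7, y 8; y 5, y 7, y 3, y 4; y 6, y 8, y 4, 1 - y 0 - y 1 - y 3]) ∧ (∀ y, ρ' y = !![y 0, y 2, y 5, y 7; y 2, y 1, y 6, y 8; y 5, y 6, y 3, y 4; y 7, y 8, y 4, 1 - y 0 - y 1 - y 3]) ∧ r.domain = {y | (ρ y).PosSemidef ∧ (ρ' y).PosSemidef} ∧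 Set.EqOn r.integrand (fun _ => 64) r.domain ∧ r'.domain = {y | (ρ y).PosSemidef} ∧ Set.EqOn r'.integrand (fun _ => 29) r'.domain ∧ c = Literature.NumberTheory.Transcendental.KZ.of r - Literature.NumberTheory.Transcendental.KZ.of r'} ∪ {c | ∃ (ρ ρ' : (Fin 15 → ℝ) → Matrix (Fin 4) (Fin 4) ℂ) (r r' : Literature.NumberTheory.Transcendental.KZ.IntegralRep 15), (∀ y, ρ y = !![((y 0 : ℝ) : ℂ), (⟨y 2, y 3⟩ : ℂ), (⟨y 7, y 8⟩ : ℂ), (⟨y 9, y 10⟩ : ℂ); (⟨y 2, -y 3⟩ : ℂ), ((y 1 : ℝ) : ℂ), (⟨y 11, y 12⟩ : ℂ), (⟨y 13, y 14⟩ : ℂ); (⟨y 7, -y 8⟩ : ℂ), (⟨y 11, -y 12⟩ : ℂ), ((y 4 : ℝ) : ℂ), (⟨y 5, y 6⟩ : ℂ); (⟨y 9, -y 10⟩ : ℂ), (⟨y 13, -y 14⟩ : ℂ), (⟨y 5, -y 6⟩ : ℂ), ((1 - y 0 - y 1 - y 4 : ℝ) : ℂ)]) ∧ (∀ y, ρ'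 y = !![((y 0 : ℝ) : ℂ), (⟨y 2, y 3⟩ : ℂ), (⟨y 7, -y 8⟩ : ℂ), (⟨y 11, -y 12⟩ : ℂ); (⟨y 2, -y 3⟩ : ℂ), ((y 1 : ℝ) : ℂ), (⟨y 9, -y 10⟩ : ℂ), (⟨y 13, -y 14⟩ : ℂ); (⟨y 7, y 8⟩ : ℂ), (⟨y 9, y 10⟩ : ℂ), ((y 4 : ℝ) : ℂ), (⟨y 5, y 6⟩ : ℂ); (⟨y 11, y 12⟩ : ℂ), (⟨y 13, y 14⟩ : ℂ), (⟨y 5, -y 6⟩ : ℂ), ((1 - y 0 - y 1 - y 4 : ℝ) : ℂ)]) ∧ r.domain = {y | (ρ y).PosSemidef ∧ (ρ' y).PosSemidef} ∧ Set.EqOn r.integrand (fun _ => 33) r.domain ∧ r'.domain = {y | (ρ y).PosSemidef} ∧ Set.EqOn r'.integrand (fun _ => 8) r'.domain ∧ c = Literature.NumberTheory.Transcendental.KZ.of r - Literature.NumberTheory.Transcendental.KZ.of r'}))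

/-- item stmt-KontsevichZagierPeriods-9264 · crux · rank 2 · open · by planner
why it might fail: Value proved in tree (ZhangJiangXie2025_qubit_fibre_separability_probability_holds). Risk = the CHAIN: plan (A) needs semialgebraic Schur/SVD cells, DefectPoly as a UNIFORM chain (open) and all π-factors cancelled unevaluated; plan (B) reaches the core only as a null slice (limit, not a move).
sources: HuongKhoi2024, ZhangJiangXie2025, LovasAndai2017, Slater2018, HorodeckiHorodecki1999, ChristandlEtAl2012
[crux] THE CENTRAL-SYMMETRY CORE, complex (card E4/E6 recast). K = {x ∈ ℝ¹² : ρ(x) ≽ 0}, ρ(x) = [[X,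
Z],[Z*, ½−X]] with X = [[x0, x2+x3i],[·, x1]], Z = [[x4+x5i, x6+x7i],[x8+x9i, x10+x11i]] — the
two-qubit states whose second marginal Tr₁ρ = X + (½−X) is maximally mixed; Core = K ∩ {½·1 − ρ(x) ≽
0} = K ∩ σK, σ = point reflection through ¼·1 (= the PPT = separable states of the fibre: ρ^Γ =
W(½·1−ρ)W*, FibreReflection). Claim: [Core, 33] ~ [K, 8] (IntegralRep 12, constant integrands).
Value: vol₁₂(Core)/vol₁₂(K) = 8/33 (HuongKhoi2024 Prop = ZhangJiangXie2025 Prop 6.9–6.10 with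
vol_HS(K) = π⁵/9676800, f(0) = 8π⁵/319334400; equivalently LovasAndai2017 Cor 2 fibre-independence +
the global 8/33); hit-and-run MC of the typed sets 0.2433 ± 0.0018, global 15-dim ratio 0.2409 ±
0.0023 (kit j000513). Two candidate chains: (A) Lovas–Andai fibration at D = ½: Schur CoV Z =
X^{1/2}C(½−X)^{1/2} (semialgebraic, Jacobian det(X)²det(½−X)²), unitary diagonalisation of X
(finite/semialgebraic SVD cells), fibre = B ∩ V_εBV_ε⁻¹ with ε² = ratio of the eigenvalues of
X(½−X)⁻¹ — then DefectPoly (rank 4) + a residual 2-dim rational-integrand identity with rational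
value (Slater2018 p. 10: 33·2048/51975 = -/
@[route_item "route-KontsevichZagierPeriods-SpectrahedralScissors", crux]
def QubitCore833 : Prop :=
  open scoped ComplexOrder in ∀ (ρ : (Fin 12 → ℝ) → Matrix (Fin 4) (Fin 4) ℂ), (∀ x, ρ x = !![((x 0 : ℝ) : ℂ), (⟨x 2, x 3⟩ : ℂ), (⟨x 4, x 5⟩ : ℂ), (⟨x 6, x 7⟩ : ℂ); (⟨x 2, -x 3⟩ : ℂ), ((x 1 : ℝ) : ℂ), (⟨x 8, x 9⟩ : ℂ), (⟨x 10, x 11⟩ : ℂ); (⟨x 4, -x 5⟩ : ℂ), (⟨x 8, -x 9⟩ : ℂ), ((1 / 2 - x 0 : ℝ) : ℂ), (⟨-x 2, -x 3⟩ : ℂ); (⟨x 6, -x 7⟩ : ℂ), (⟨x 10, -x 11⟩ : ℂ), (⟨-x 2, x 3⟩ : ℂ), ((1 / 2 - x 1 : ℝ) : ℂ)]) → ∀ (r r' : Literature.NumberTheory.Transcendental.KZ.IntegralRep 12), r.domain = {x | (ρ x).PosSemidef ∧ ((2 : ℂ)⁻¹ • (1 : Matrix (Fin 4) (Fin 4)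 ℂ) - ρ x).PosSemidef} → Set.EqOn r.integrand (fun _ => 33) r.domain → r'.domain = {x | (ρ x).PosSemidef} → Set.EqOn r'.integrand (fun _ => 8) r'.domain → Literature.NumberTheory.Transcendental.KZ.Equivalent r r'

/-- item stmt-KontsevichZagierPeriods-9265 · crux · rank 3 · open · by planner
why it might fail: Value proved in tree (LovasAndai2017_rebit_fibre_separability_probability_holds). Chain risk: LA's closing primitive (Li₂, log·log) is not semialgebraic (barrier noSemialgebraicPrimitive_inv_sub_two): both logs ride as extra variables; the weight-2 cancellation to (3/256)π² must be redone by moves.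
sources: LovasAndai2017, Slater2018, KontsevichZagier2001
[crux] THE CENTRAL-SYMMETRY CORE, real (card E3 on the fibre). K_ℝ = {x ∈ ℝ⁷ : ρ(x) ≽ 0}, ρ(x) =
[[X, Z],[Zᵀ, ½−X]], X = [[x0,x2],[x2,x1]], Z = [[x3,x4],[x5,x6]] (two-rebit states with maximally
mixed second marginal); Core_ℝ = K_ℝ ∩ {½·1 − ρ ≽ 0}. Claim: [Core_ℝ, 64] ~ [K_ℝ, 29] (IntegralRep
7). Value: LovasAndai2017 Thm 2 (29/64) with Cor 2 (the conditional PPT probability is independent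
of the marginal D; Thm 2 is computed FROM the fibre formula eq. (psep)); hit-and-run MC of the typed
sets 0.4530 ± 0.0021, and 0.4528 ± 0.0021 on the fibre over D = diag(.7,.3), global 9-dim ratio
0.4526 ± 0.0020 (kit j000513). Foreseen chain = LA's proof made semialgebraic (≈ 30 moves): Schur
CoV Z = X^{1/2}C(½−X)^{1/2} (Jacobian det X·det(½−X)); rotation cells diagonalising X
(tan-half-angle chart, Jacobian |ξ₁−ξ₂|, the angular factor [ℝ, 2/(1+t²)] carried as a spectator on
BOTH sides, never integrated out); fibre = B_ℝ ∩ V_εB_ℝV_ε⁻¹ handled by DefectLogRebit (LA Lemma 6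
as a uniform chain, App. A: in the chart (r, w = e^t, ρ, tan φ/2) the conjugation is the scaling w ↦
εw and the volume form is r³); LA p. 8: u = (1−x)/(1+x), (u,v) ↦ (ts, s/t) (rule 2), one integration
by parts (rules 1+3, rati -/
@[route_item "route-KontsevichZagierPeriods-SpectrahedralScissors", crux]
def RebitCore2964 : Prop :=
  ∀ (ρ : (Fin 7 → ℝ) → Matrix (Fin 4) (Fin 4) ℝ), (∀ x, ρ x = !![x 0, x 2, x 3, x 4; x 2, x 1, x 5, x 6; x 3, x 5, 1 / 2 - x 0, -x 2; x 4, x 6, -x 2, 1 / 2 - x 1]) → ∀ (r r' : Literature.NumberTheory.Transcendental.KZ.IntegralRep 7), r.domain = {x | (ρ x).PosSemidef ∧ ((2 : ℝ)⁻¹ • (1 : Matrix (Fin 4) (Fin 4) ℝ) - ρ x).PosSemidef} → Set.EqOn r.integrand (fun _ => 64) r.domain → r'.domain = {x | (ρ x).PosSemidef} → Set.EqOn r'.integrand (fun _ => 29) r'.domain → Literature.NumberTheory.Transcendental.KZ.Equivalent r r'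

/-- item stmt-KontsevichZagierPeriods-9266 · crux · rank 4 · open · by planner
why it might fail: Value settled TRUE in tree: vol₈(B∩V_εBV_ε⁻¹) = (π⁴/36)ε²(4−ε²), vol₈(B) = π⁴/12 (ZhangJiangXie2025.volume_Ebody_eq = Slater's χ̃₂). What can fail is the UNIFORM chain in rational ε: disc-fibre radii are algebraic (√), the min-cell split semialgebraic, but three π's must cancel unevaluated.
sources: Slater2018, LovasAndai2017, ZhangJiangXie2025, HuongKhoi2024
[crux] SLATER'S DEFECT IDENTITY as a uniform family of 8-dim instances (card E4). B = operator-norm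
unit ball of ℂ^{2×2} in real coordinates z ∈ ℝ⁸ (M = [[z0+z1i, z2+z3i],[z4+z5i, z6+z7i]]; ‖M‖ ≤ 1 ⟺
Tr M*M ≤ 2 ∧ det(1 − M*M) = 1 − Σz² + |det M|² ≥ 0 — polynomial), and for rational ε ∈ (0,1] the
conjugate condition ‖V_ε⁻¹MV_ε‖ ≤ 1, V_ε = diag(1, ε) (entries b ↦ εb, c ↦ c/ε; written ×ε² as
polynomials). Claim: [B ∩ V_εBV_ε⁻¹, 3] ~ [B, ε²(4−ε²)] for every rational 0 < ε ≤ 1, i.e.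
Lovas–Andai's χ̃₂(ε) = ε²(4−ε²)/3 with a rules-proof uniform in ε (parameter-as-variable: d/dε of
the moving wall as Newton–Leibniz in ε with a semialgebraic primitive — polynomiality of a period
function is the one case where a rules-proof is easier than an analytic one). Under it, plan (A) of
QubitCore833 has no transcendental step at all. Value status: CONJECTURAL (Slater2018 eq.
(VerifiedFormula), from cylindrical algebraic decomposition on the 11-dim subfamily with diagonal
D₁, D₂, validated only through the sum rule ∫χ̃₂ dμ = 8/33 — now a theorem — and sampling); planner
MC (kit j000373, 8-dim rejection, 3.2M samples each): χ̃₂(0.5) = 0.3160±0.0015 (formula 0.3125),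
χ̃₂(0.7) = 0.5721±0.0016 (0.5733), χ -/
@[route_item "route-KontsevichZagierPeriods-SpectrahedralScissors"]
def DefectPoly : Prop :=
  ∀ ε : ℚ, 0 < ε → ε ≤ 1 → ∀ (r r' : Literature.NumberTheory.Transcendental.KZ.IntegralRep 8), r.domain = {z | (∑ i, z i ^ 2 ≤ 2 ∧ 0 ≤ 1 - ∑ i, z i ^ 2 + (z 0 * z 6 - z 1 * z 7 - z 2 * z 4 + z 3 * z 5) ^ 2 + (z 0 * z 7 + z 1 * z 6 - z 2 * z 5 - z 3 * z 4) ^ 2) ∧ ((ε : ℝ) ^ 2 * (z 0 ^ 2 + z 1 ^ 2) + (ε : ℝ) ^ 4 * (z 2 ^ 2 + z 3 ^ 2) + (z 4 ^ 2 + z 5 ^ 2) + (ε : ℝ) ^ 2 * (z 6 ^ 2 + z 7 ^ 2) ≤ 2 * (ε : ℝ) ^ 2 ∧ 0 ≤ (ε : ℝ) ^ 2 - ((ε : ℝ) ^ 2 * (z 0 ^ 2 + z 1 ^ 2) + (ε : ℝ) ^ 4 * (z 2 ^ 2 + z 3 ^ 2) + (z 4 ^ 2 + z 5 ^ 2) +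 (ε : ℝ) ^ 2 * (z 6 ^ 2 + z 7 ^ 2)) + (ε : ℝ) ^ 2 * ((z 0 * z 6 - z 1 * z 7 - z 2 * z 4 + z 3 * z 5) ^ 2 + (z 0 * z 7 + z 1 * z 6 - z 2 * z 5 - z 3 * z 4) ^ 2))} → Set.EqOn r.integrand (fun _ => 3) r.domain → r'.domain = {z | ∑ i, z i ^ 2 ≤ 2 ∧ 0 ≤ 1 - ∑ i, z i ^ 2 + (z 0 * z 6 - z 1 * z 7 - z 2 * z 4 + z 3 * z 5) ^ 2 + (z 0 * z 7 + z 1 * z 6 - z 2 * z 5 - z 3 * z 4) ^ 2} → Set.EqOn r'.integrand (fun _ => (ε : ℝ) ^ 2 * (4 - (ε : ℝ) ^ 2)) r'.domain → Literature.NumberTheory.Transcendental.KZ.Equivalent r r'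

-- earlier SpectralShellDH (stmt-KontsevichZagierPeriods-9682, replaced 2026-08-15T16:38:00Z -> stmt-KontsevichZagierPeriods-11068): retired by None — open scoped ComplexOrder in ∀ (ρ : (Fin 15 → ℝ) → Matrix (Fin 4) (Fin 4) ℂ), (∀ y, ρ y = !![((y 0 : ℝ) : ℂ), (⟨y 2, y 3⟩ : ℂ), (⟨y 7, y 8⟩ : ℂ), (⟨y 9, y 10⟩ : ℂ); (⟨y 2, -y 3⟩ : ℂ), ((y 1 : ℝ) : ℂ), (⟨y 11, y 12⟩ : ℂ), (⟨y 13, y 14⟩ : ℂ); (⟨y 7, -y 8⟩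
/-- item stmt-KontsevichZagierPeriods-11068 · crux (kind.auto-crux: conjecture-grade) · rank 6 · open · by planner
why it might fail: Values are theorems (ZJX25 Props 6.6/6.7/6.10, Huong24). As a CHAIN the non-abelian DH density is a distributional derivative of the abelian one (derivative principle — not a move): needs semialgebraic action-angle coordinates for U(2) ⊂ U(4); a slipped coefficient in I, J makes it false-as-typed.
sources: ZhangJiangXie2025, HuongKhoi2024, LovasAndai2017, ChristandlEtAl2012
[support, rank 6 — plan (B) of QubitCore833] SPECTRAL SHELL RATIO (non-abelian Duistermaat–Heckman
for the partial trace, as a uniform family of Conjecture-1 instances in Transport's 15-dim complex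
chart). D = {ρ(y) ≽ 0} (two-qubit states, Tr ρ = 1 built in), E = D ∩ {½·1 − ρ ≽ 0} (λ_max ≤ ½;
U(4)-invariant; on the zero-Bloch fibre E = PPT = separable, ZhangJiangXie2025 Prop 6.9 =
HuongKhoi2024), b = Bloch vector of the marginal Tr₁ρ, |b|² = (2(y0+y4)−1)² + 4(y2+y5)² + 4(y3+y6)²
(polynomial). Claim: for every rational 0 < t < 1/3 the shells E_t = E ∩ {|b| ≤ t} and D_t = D ∩
{|b| ≤ t} satisfy [E_t, 33·J(t)] ~ [D_t, I(t)] (IntegralRep 15, constant integrands), where J(t) =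
∫₀ᵗ a²(1−a²)⁶ da = t³/3 − 6t⁵/5 + 15t⁷/7 − 20t⁹/9 + 15t¹¹/11 − 6t¹³/13 + t¹⁵/15 and I(t) = ∫₀ᵗ
a²(1−a)⁹(33a³+162a²+72a+8) da = 8t³/3 − 198t⁵/5 + 165t⁶/2 + 495t⁷/7 − 1089t⁸/2 + 3080t⁹/3 −
5247t¹⁰/5 + 630t¹¹ − 605t¹²/3 + 198t¹³/13 + 135t¹⁴/14 − 11t¹⁵/15 (exact; re-verified). VALUE side
(theorem): vol(E_t)/vol(D_t) = I(t)/(33·J(t)) by ZhangJiangXie2025 Prop 6.6 (vol = (π/2)∫₀ᵗ a²·vol^a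
da, page p14), Prop 6.7 (vol^a(D) = (π⁵/9676800)(1−a²)⁶, LovasAndai2017; p14–15) and Prop 6.10 (f(a)
= vol^a(E) = (π⁵/319334400)(1−a)⁹ -/
@[route_item "route-KontsevichZagierPeriods-SpectrahedralScissors"]
def SpectralShellDH : Prop :=
  open scoped ComplexOrder in ∀ (ρ : (Fin 15 → ℝ) → Matrix (Fin 4) (Fin 4) ℂ), (∀ y, ρ y = !![((y 0 : ℝ) : ℂ), (⟨y 2, y 3⟩ : ℂ), (⟨y 7, y 8⟩ : ℂ), (⟨y 9, y 10⟩ : ℂ); (⟨y 2, -y 3⟩ : ℂ), ((y 1 : ℝ) : ℂ), (⟨y 11, y 12⟩ : ℂ), (⟨y 13, y 14⟩ : ℂ); (⟨y 7, -y 8⟩ : ℂ), (⟨y 11, -y 12⟩ : ℂ), ((y 4 : ℝ) : ℂ), (⟨y 5, y 6⟩ : ℂ); (⟨y 9, -y 10⟩ : ℂ), (⟨y 13, -y 14⟩ : ℂ), (⟨y 5, -y 6⟩ : ℂ), ((1 - y 0 - y 1 - y 4 : ℝ) : ℂ)]) → ∀ t : ℚ, 0 < t → t < 1 / 3 → ∀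 (r r' : Literature.NumberTheory.Transcendental.KZ.IntegralRep 15), r.domain = {y | (ρ y).PosSemidef ∧ ((2 : ℂ)⁻¹ • (1 : Matrix (Fin 4) (Fin 4) ℂ) - ρ y).PosSemidef ∧ (2 * (y 0 + y 4) - 1) ^ 2 + 4 * (y 2 + y 5) ^ 2 + 4 * (y 3 + y 6) ^ 2 ≤ (t : ℝ) ^ 2} → Set.EqOn r.integrand (fun _ => 33 * ((t : ℝ) ^ 3 / 3 - 6 * (t : ℝ) ^ 5 / 5 + 15 * (t : ℝ) ^ 7 / 7 - 20 * (t : ℝ) ^ 9 / 9 + 15 * (t : ℝ) ^ 11 / 11 - 6 * (t : ℝ) ^ 13 / 13 + (t : ℝ) ^ 15 / 15)) r.domain → r'.domain = {y | (ρ y).PosSemidef ∧ (2 * (y 0 + y 4) - 1) ^ 2 + 4 * (y 2 + y 5) ^ 2 + 4 * (y 3 + y 6) ^ 2 ≤ (t : ℝ) ^ 2} → Set.EqOn r'.integrand (fun _ => (8 / 3 * (t : ℝ) ^ 3 - 198 / 5 * (t : ℝ) ^ 5 + 165 / 2 * (t : ℝ) ^ 6 + 495 / 7 * (t : ℝ)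 ^ 7 - 1089 / 2 * (t : ℝ) ^ 8 + 3080 / 3 * (t : ℝ) ^ 9 - 5247 / 5 * (t : ℝ) ^ 10 + 630 * (t : ℝ) ^ 11 - 605 / 3 * (t : ℝ) ^ 12 + 198 / 13 * (t : ℝ) ^ 13 + 135 / 14 * (t : ℝ) ^ 14 - 11 / 5 * (t : ℝ) ^ 15)) r'.domain → Literature.NumberTheory.Transcendental.KZ.Equivalent r r'

/-- item stmt-KontsevichZagierPeriods-9267 · support · rank 5 · open · by planner
why it might fail: As typed only: a slipped block/conjugation convention between fibre and global charts (guarded: the 15-dim chart is verbatim Literature's twoQubitMatrix/twoQubitMatrixPT, cf. TwoQubitSeparabilityVolumesKZ.kz_value_eq by funext/rfl).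
sources: MilzStrunz2014, LovasAndai2017, KontsevichZagier2001
[crux] MILZ–STRUNZ INVARIANCE AS A CHAIN (card E5): the two fibre instances imply the two GLOBAL
Conjecture-1 instances Rebit2964 ∧ Qubit833 — [P_ℝ, 64] ~ [D_ℝ, 29] in dimension 9 (coordinates y: X
= [[y0,y2],[y2,y1]], Y = [[y3,y4],[y4,1−y0−y1−y3]], Z = [[y5,y6],[y7,y8]], ρ = [[X,Z],[Zᵀ,Y]], ρ^Γ =
[[X,Zᵀ],[Z,Y]]) and [P_ℂ, 33] ~ [D_ℂ, 8] in dimension 15 (X = [[y0, y2+y3i],[·,y1]], Y = [[y4,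
y5+y6i],[·, 1−y0−y1−y4]], Z = [[y7+y8i, y9+y10i],[y11+y12i, y13+y14i]], ρ = [[X,Z],[Z*,Y]], ρ^Γ =
[[X,Z*],[Z,Y]] = partial transpose on the first factor; domains = PSD sets, integrands the
constants; values 64·vol P_ℝ = 29·vol D_ℝ, LovasAndai2017 Thm 2, and 33·vol P_ℂ = 8·vol D_ℂ,
HuongKhoi2024; hit-and-run MC of exactly these sets, kit j000513: global 0.2409±0.0023 and
0.4526±0.0020). Mechanism: the local filtering (1⊗L)ρ₀(1⊗L)*, L = Cholesky factor of 2ρ_B over the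
open Bloch ball (semialgebraic section), maps base × K bijectively onto the faithful-marginal part
of D (complement null), is linear in ρ₀ with fibre Jacobian |det L|^{12} = det(2ρ_B)⁶ (complex; |det
L|⁷ = det(2ρ_B)^{7/2} real — LovasAndai2017 Thm 1 exponents 4d − d²/2), preserves ≽ 0 and commutes
with Γ on the first factor, so ONE -/
@[route_item "route-KontsevichZagierPeriods-SpectrahedralScissors", crux]
def Transport : Prop :=
  QubitCore833 → RebitCore2964 → ((∀ (ρ ρ' : (Fin 9 → ℝ) → Matrix (Fin 4) (Fin 4) ℝ), (∀ y, ρ y = !![y 0, y 2, y 5, y 6; y 2, y 1, y 7, y 8; y 5, y 7, y 3, y 4; y 6, y 8, y 4, 1 - y 0 - y 1 - y 3]) → (∀ y, ρ' y = !![y 0, y 2, y 5, y 7; y 2, y 1, y 6, y 8; y 5, y 6, y 3, y 4; y 7, y 8, y 4, 1 - y 0 - y 1 - y 3]) → ∀ (r r' : Literature.NumberTheory.Transcendental.KZ.IntegralRep 9), r.domain = {y | (ρ y).PosSemidef ∧ (ρ' y).PosSemidef} → Set.EqOn r.integrand (fun _ => 64) r.domain → r'.domain = {y | (ρ y).PosSemidef}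 → Set.EqOn r'.integrand (fun _ => 29) r'.domain → Literature.NumberTheory.Transcendental.KZ.Equivalent r r') ∧ (open scoped ComplexOrder in ∀ (ρ ρ' : (Fin 15 → ℝ) → Matrix (Fin 4) (Fin 4) ℂ), (∀ y, ρ y = !![((y 0 : ℝ) : ℂ), (⟨y 2, y 3⟩ : ℂ), (⟨y 7, y 8⟩ : ℂ), (⟨y 9, y 10⟩ : ℂ); (⟨y 2, -y 3⟩ : ℂ), ((y 1 : ℝ) : ℂ), (⟨y 11, y 12⟩ : ℂ), (⟨y 13, y 14⟩ : ℂ); (⟨y 7, -y 8⟩ : ℂ), (⟨y 11, -y 12⟩ : ℂ), ((y 4 : ℝ) : ℂ), (⟨y 5, y 6⟩ : ℂ); (⟨y 9, -y 10⟩ : ℂ), (⟨y 13, -y 14⟩ : ℂ), (⟨y 5, -y 6⟩ : ℂ), ((1 - y 0 - y 1 - y 4 : ℝ) : ℂ)]) → (∀ y, ρ' y = !![((y 0 : ℝ) : ℂ), (⟨y 2, y 3⟩ : ℂ), (⟨y 7, -y 8⟩ : ℂ), (⟨y 11, -y 12⟩ : ℂ); (⟨y 2, -y 3⟩ : ℂ),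 ((y 1 : ℝ) : ℂ), (⟨y 9, -y 10⟩ : ℂ), (⟨y 13, -y 14⟩ : ℂ); (⟨y 7, y 8⟩ : ℂ), (⟨y 9, y 10⟩ : ℂ), ((y 4 : ℝ) : ℂ), (⟨y 5, y 6⟩ : ℂ); (⟨y 11, y 12⟩ : ℂ), (⟨y 13, y 14⟩ : ℂ), (⟨y 5, -y 6⟩ : ℂ), ((1 - y 0 - y 1 - y 4 : ℝ) : ℂ)]) → ∀ (r r' : Literature.NumberTheory.Transcendental.KZ.IntegralRep 15), r.domain = {y | (ρ y).PosSemidef ∧ (ρ' y).PosSemidef} → Set.EqOn r.integrand (fun _ => 33) r.domain → r'.domain = {y | (ρ y).PosSemidef} → Set.EqOn r'.integrand (fun _ => 8) r'.domain → Literature.NumberTheory.Transcendental.KZ.Equivalent r r'))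

-- earlier SectorOfSummit (stmt-KontsevichZagierPeriods-9269, replaced 2026-08-15T16:38:00Z -> stmt-KontsevichZagierPeriods-11067): retired by None — (Literature.NumberTheory.Transcendental.KZKernelConjecture → SeparabilityKernel) ∧ (KontsevichZagierPeriods → (∀ (ρ ρ' : (Fin 9 → ℝ) → Matrix (Fin 4) (Fin 4) ℝ), (∀ y, ρ y = !![y 0, y 2, y 5, y 6; y 2, y 1, y 7, y 8; y 5, y 7, y 3, y 4; y 6, y 8, y 4, 1
/-- item stmt-KontsevichZagierPeriods-11067 · support · rank 9 · open · by planner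
sources: KontsevichZagier2001, LovasAndai2017, HuongKhoi2024
[support] LOGICAL POSITION, both directions (route-repair rev 3: the kernel conjecture is written
UNFOLDED — `∀ c, KZ.eval c = 0 → c ∈ KZ.relations`, verbatim the body of
`Literature.NumberTheory.Transcendental.KZKernelConjecture` — so that no @[conjecture] constant
enters the route's cone; meaning unchanged): (a) (kernel form of Conjecture 1) → SeparabilityKernel
(closure is monotone; the target is summit-strength, not weaker); (b) KontsevichZagierPeriods →
(64·vol P_ℝ = 29·vol D_ℝ, as value equality of the typed 9-dim representations) → (33·vol P_ℂ =
8·vol D_ℂ, dimension 15) → Rebit2964 ∧ Qubit833 (constant integrands over ℚ-semialgebraic PSD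
domains are IsRational with p = C, q = 1), so each instance and each fibre core is a NECESSARY
condition of the summit: a genuine non-derivability proof refutes the summit. Value hypotheses =
LovasAndai2017 Thm 2, HuongKhoi2024 (vendored:
Literature/Probability/RandomMatrix/TwoQubitSeparabilityVolumes.lean). [difficulty: provable-now]
Sources: KontsevichZagier2001, LovasAndai2017, HuongKhoi2024. -/
@[route_item "route-KontsevichZagierPeriods-SpectrahedralScissors"]
def SectorOfSummit : Prop :=
  ((∀ c : Literature.NumberTheory.Transcendental.KZ.FormalRep, Literature.NumberTheory.Transcendental.KZ.eval c = 0 → c ∈ Literature.NumberTheory.Transcendental.KZ.relations) → SeparabilityKernel) ∧ (KontsevichZagierPeriods → (∀ (ρ ρ' : (Fin 9 → ℝ) → Matrix (Fin 4) (Fin 4) ℝ), (∀ y, ρ y = !![y 0, y 2, y 5, y 6; y 2, y 1, y 7, y 8; y 5, y 7, y 3, y 4; y 6, y 8, y 4, 1 - y 0 - y 1 - y 3]) → (∀ y, ρ' y = !![y 0, y 2, y 5, y 7; y 2, y 1, y 6, y 8; y 5, y 6, y 3, y 4; y 7, y 8, y 4, 1 - y 0 - y 1 - y 3]) → ∀ (r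 r' : Literature.NumberTheory.Transcendental.KZ.IntegralRep 9), r.domain = {y | (ρ y).PosSemidef ∧ (ρ' y).PosSemidef} → Set.EqOn r.integrand (fun _ => 64) r.domain → r'.domain = {y | (ρ y).PosSemidef} → Set.EqOn r'.integrand (fun _ => 29) r'.domain → r.value = r'.value) → (open scoped ComplexOrder in ∀ (ρ ρ' : (Fin 15 → ℝ) → Matrix (Fin 4) (Fin 4) ℂ), (∀ y, ρ y = !![((y 0 : ℝ) : ℂ), (⟨y 2, y 3⟩ : ℂ), (⟨y 7, y 8⟩ : ℂ), (⟨y 9, y 10⟩ : ℂ); (⟨y 2, -y 3⟩ : ℂ), ((y 1 : ℝ) : ℂ), (⟨y 11, y 12⟩ : ℂ), (⟨y 13, y 14⟩ : ℂ); (⟨y 7, -y 8⟩ : ℂ), (⟨y 11, -y 12⟩ : ℂ), ((y 4 : ℝ) : ℂ), (⟨y 5, y 6⟩ : ℂ); (⟨y 9, -y 10⟩ : ℂ), (⟨y 13, -y 14⟩ : ℂ), (⟨y 5, -y 6⟩ : ℂ), ((1 - y 0 - y 1 - y 4 : ℝ) : ℂ)]) → (∀ y, ρ' y = !![((y 0 :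 ℝ) : ℂ), (⟨y 2, y 3⟩ : ℂ), (⟨y 7, -y 8⟩ : ℂ), (⟨y 11, -y 12⟩ : ℂ); (⟨y 2, -y 3⟩ : ℂ), ((y 1 : ℝ) : ℂ), (⟨y 9, -y 10⟩ : ℂ), (⟨y 13, -y 14⟩ : ℂ); (⟨y 7, y 8⟩ : ℂ), (⟨y 9, y 10⟩ : ℂ), ((y 4 : ℝ) : ℂ), (⟨y 5, y 6⟩ : ℂ); (⟨y 11, y 12⟩ : ℂ), (⟨y 13, y 14⟩ : ℂ), (⟨y 5, -y 6⟩ : ℂ), ((1 - y 0 - y 1 - y 4 : ℝ) : ℂ)]) → ∀ (r r' : Literature.NumberTheory.Transcendental.KZ.IntegralRep 15), r.domain = {y | (ρ y).PosSemidef ∧ (ρ' y).PosSemidef} → Set.EqOn r.integrand (fun _ => 33) r.domain → r'.domain = {y | (ρ y).PosSemidef} → Set.EqOn r'.integrand (fun _ => 8) r'.domain → r.value = r'.value) → ((∀ (ρ ρ' : (Fin 9 → ℝ) → Matrix (Fin 4) (Fin 4) ℝ), (∀ y, ρ y = !![y 0, y 2, y 5, y 6; y 2, y 1, y 7, y 8;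 y 5, y 7, y 3, y 4; y 6, y 8, y 4, 1 - y 0 - y 1 - y 3]) → (∀ y, ρ' y = !![y 0, y 2, y 5, y 7; y 2, y 1, y 6, y 8; y 5, y 6, y 3, y 4; y 7, y 8, y 4, 1 - y 0 - y 1 - y 3]) → ∀ (r r' : Literature.NumberTheory.Transcendental.KZ.IntegralRep 9), r.domain = {y | (ρ y).PosSemidef ∧ (ρ' y).PosSemidef} → Set.EqOn r.integrand (fun _ => 64) r.domain → r'.domain = {y | (ρ y).PosSemidef} → Set.EqOn r'.integrand (fun _ => 29) r'.domain → Literature.NumberTheory.Transcendental.KZ.Equivalent r r') ∧ (open scoped ComplexOrder in ∀ (ρ ρ' : (Fin 15 → ℝ) → Matrix (Fin 4) (Fin 4) ℂ), (∀ y, ρ y = !![((y 0 : ℝ) : ℂ), (⟨y 2, y 3⟩ : ℂ), (⟨y 7, y 8⟩ : ℂ), (⟨y 9, y 10⟩ : ℂ); (⟨y 2, -y 3⟩ : ℂ), ((y 1 : ℝ) : ℂ), (⟨y 11, y 12⟩ : ℂ), (⟨y 13, y 14⟩ : ℂ); (⟨y 7, -y 8⟩ : ℂ), (⟨y 11, -y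 12⟩ : ℂ), ((y 4 : ℝ) : ℂ), (⟨y 5, y 6⟩ : ℂ); (⟨y 9, -y 10⟩ : ℂ), (⟨y 13, -y 14⟩ : ℂ), (⟨y 5, -y 6⟩ : ℂ), ((1 - y 0 - y 1 - y 4 : ℝ) : ℂ)]) → (∀ y, ρ' y = !![((y 0 : ℝ) : ℂ), (⟨y 2, y 3⟩ : ℂ), (⟨y 7, -y 8⟩ : ℂ), (⟨y 11, -y 12⟩ : ℂ); (⟨y 2, -y 3⟩ : ℂ), ((y 1 : ℝ) : ℂ), (⟨y 9, -y 10⟩ : ℂ), (⟨y 13, -y 14⟩ : ℂ); (⟨y 7, y 8⟩ : ℂ), (⟨y 9, y 10⟩ : ℂ), ((y 4 : ℝ) : ℂ), (⟨y 5, y 6⟩ : ℂ); (⟨y 11, y 12⟩ : ℂ), (⟨y 13, y 14⟩ : ℂ), (⟨y 5, -y 6⟩ : ℂ), ((1 - y 0 - y 1 - y 4 : ℝ) : ℂ)]) → ∀ (r r' : Literature.NumberTheory.Transcendental.KZ.IntegralRep 15), r.domain = {y | (ρ y).PosSemidef ∧ (ρ' y).PosSemidef} → Set.EqOn r.integrand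 (fun _ => 33) r.domain → r'.domain = {y | (ρ y).PosSemidef} → Set.EqOn r'.integrand (fun _ => 8) r'.domain → Literature.NumberTheory.Transcendental.KZ.Equivalent r r')))

/-- item stmt-KontsevichZagierPeriods-9268 · support · rank 9 · closed · proved by Summit.KontsevichZagierPeriods.SpectrahedralScissors.fibreReflection_proof @ 5c628d285a1d (prover) · by planner
sources: HorodeckiHorodecki1999, HuongKhoi2024, ZhangJiangXie2025
[support] PPT = CENTRAL REFLECTION ON THE FIBRE (Huong–Khoi's spectral criterion = the reduction
criterion of HorodeckiHorodecki1999 for qubits): for the real 7-dim and complex 12-dim fibre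
parametrisations, ρ(x)^Γ ≽ 0 ↔ ½·1 − ρ(x) ≽ 0, because ρ^Γ = (DS)(½·1 − ρ)(DS)ᵀ with S the block
swap and D = diag(1,1,−1,−1) (uses only X + Y = ½·1). Three-line matrix identity +
`Matrix.PosSemidef` congruence lemmas; links the cores of QubitCore833/RebitCore2964 to the literal
PPT bodies of Target (needed inside Transport). [difficulty: provable-now] -/
@[route_item "route-KontsevichZagierPeriods-SpectrahedralScissors"]
def FibreReflection : Prop :=
  (∀ x : Fin 7 → ℝ, (!![x 0, x 2, x 3, x 5; x 2, x 1, x 4, x 6; x 3, x 4, 1 / 2 - x 0, -x 2; x 5, x 6, -x 2, 1 / 2 - x 1] : Matrix (Fin 4) (Fin 4) ℝ).PosSemidef ↔ ((2 : ℝ)⁻¹ • (1 : Matrix (Fin 4) (Fin 4) ℝ) - !![x 0, x 2, x 3, x 4; x 2, x 1, x 5, x 6; x 3, x 5, 1 / 2 - x 0, -x 2; x 4, x 6, -x 2, 1 / 2 - x 1]).PosSemidef) ∧ (open scoped ComplexOrder in ∀ x : Fin 12 → ℝ, (!![((x 0 : ℝ) : ℂ), (⟨x 2, x 3⟩ : ℂ),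 (⟨x 4, -x 5⟩ : ℂ), (⟨x 8, -x 9⟩ : ℂ); (⟨x 2, -x 3⟩ : ℂ), ((x 1 : ℝ) : ℂ), (⟨x 6, -x 7⟩ : ℂ), (⟨x 10, -x 11⟩ : ℂ); (⟨x 4, x 5⟩ : ℂ), (⟨x 6, x 7⟩ : ℂ), ((1 / 2 - x 0 : ℝ) : ℂ), (⟨-x 2, -x 3⟩ : ℂ); (⟨x 8, x 9⟩ : ℂ), (⟨x 10, x 11⟩ : ℂ), (⟨-x 2, x 3⟩ : ℂ), ((1 / 2 - x 1 : ℝ) : ℂ)] : Matrix (Fin 4) (Fin 4) ℂ).PosSemidef ↔ ((2 : ℂ)⁻¹ • (1 : Matrix (Fin 4) (Fin 4) ℂ) - !![((x 0 : ℝ) : ℂ), (⟨x 2, x 3⟩ : ℂ), (⟨x 4, x 5⟩ : ℂ), (⟨x 6, x 7⟩ : ℂ); (⟨x 2, -x 3⟩ : ℂ), ((x 1 : ℝ) : ℂ), (⟨x 8, x 9⟩ : ℂ), (⟨x 10, x 11⟩ : ℂ); (⟨x 4, -x 5⟩ : ℂ), (⟨x 8, -x 9⟩ : ℂ), ((1 /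 2 - x 0 : ℝ) : ℂ), (⟨-x 2, -x 3⟩ : ℂ); (⟨x 6, -x 7⟩ : ℂ), (⟨x 10, -x 11⟩ : ℂ), (⟨-x 2, x 3⟩ : ℂ), ((1 / 2 - x 1 : ℝ) : ℂ)]).PosSemidef)

/-- item stmt-KontsevichZagierPeriods-9270 · support · rank 9 · open · by planner
sources: LovasAndai2017, Slater2018
[support] LOVAS–ANDAI LEMMA 6 AS A UNIFORM CHAIN (first brick of RebitCore2964): for rational 0 < ε
≤ 1, [B_ℝ ∩ V_εB_ℝV_ε⁻¹, 3] (IntegralRep 4; B_ℝ = {z : Σz² ≤ 2, 1 − Σz² + (z0z3 − z1z2)² ≥ 0} the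
operator-norm ball of ℝ^{2×2}) ~ the 2-dim rational representation [{0 < t < s < ε}, 8((s²+1)/s³ −
(s²−1)²/(s³(1−t²)))] (log((1+s)/(1−s)) unfolded as ∫₀^s 2dt/(1−t²)); value 3χ₁(ε) = 8∫₀^ε (s + 1/s −
½(s−1/s)² log((1+s)/(1−s))) ds/s (χ₁(1) = 2π²/3; LovasAndai2017 Lemma 6 + Table 2, PROVED there,
App. A; planner MC χ̃₁(0.5) = 0.5312 ± 0.0004 = Simpson of Lemma 6, kit j000373). Chain: LA's App. A
atlas X = rY±(t,ρ,φ) with w = e^t, u = tan(φ/2) is semialgebraic, the similarity by Λ_δ is the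
scaling w ↦ e^{−δ}w, √det g = r³ (NL in r, primitive r⁴/4), the comparison ‖Y(t−δ)‖ > ‖Y(t)‖ ⟺ t <
δ/2 is a semialgebraic cell split, and the (ρ,φ)-integrals of p. 15 have rational primitives up to
the one log kept as a variable. [difficulty: M] -/
@[route_item "route-KontsevichZagierPeriods-SpectrahedralScissors"]
def DefectLogRebit : Prop :=
  ∀ ε : ℚ, 0 < ε → ε ≤ 1 → ∀ (r : Literature.NumberTheory.Transcendental.KZ.IntegralRep 4) (r' : Literature.NumberTheory.Transcendental.KZ.IntegralRep 2), r.domain = {z | (∑ i, z i ^ 2 ≤ 2 ∧ 0 ≤ 1 - ∑ i, z i ^ 2 + (z 0 * z 3 - z 1 * z 2) ^ 2) ∧ ((ε : ℝ) ^ 2 * z 0 ^ 2 + (ε : ℝ) ^ 4 * z 1 ^ 2 + z 2 ^ 2 + (ε : ℝ) ^ 2 * z 3 ^ 2 ≤ 2 * (ε : ℝ) ^ 2 ∧ 0 ≤ (ε : ℝ) ^ 2 - ((ε : ℝ) ^ 2 * z 0 ^ 2 + (ε : ℝ) ^ 4 * z 1 ^ 2 + z 2 ^ 2 + (ε : ℝ)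 ^ 2 * z 3 ^ 2) + (ε : ℝ) ^ 2 * (z 0 * z 3 - z 1 * z 2) ^ 2)} → Set.EqOn r.integrand (fun _ => 3) r.domain → r'.domain = {w | 0 < w 1 ∧ w 1 < w 0 ∧ w 0 < (ε : ℝ)} → Set.EqOn r'.integrand (fun w => 8 * ((w 0 ^ 2 + 1) / w 0 ^ 3 - (w 0 ^ 2 - 1) ^ 2 / (w 0 ^ 3 * (1 - w 1 ^ 2)))) r'.domain → Literature.NumberTheory.Transcendental.KZ.Equivalent r r'

/-- item stmt-KontsevichZagierPeriods-9271 · support · rank 9 · open · by planner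
sources: Slater2018, MilzStrunz2014
[support] X-STATES CALIBRATION (toy rung, provable now): two-qubit X-states ρ =
[[a,0,0,w],[0,b,z,0],[0,z̄,c,0],[w̄,0,0,d]], a+b+c+d = 1, form the 7-dim body D_X = {a,b,c,d ≥ 0,
|w|² ≤ ad, |z|² ≤ bc}; PPT_X = D_X ∩ {|w|² ≤ bc, |z|² ≤ ad}. Claim [PPT_X, 5] ~ [D_X, 2]
(Dunkl–Slater 2015: HS separability probability of X-states = 2/5, reproduced in Slater2018 §;
planner check E[min(ad,bc)²]/E[abcd] = 0.40003, kit j000504). Chain: disc fibres w = √(ad)·u (rule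
2, Jacobian ad) make both sides [Δ-cells, polynomial]⋆[disc]⋆[disc]; split Δ along ad = bc (c =
a(1−a−b)/(a+b), rational); iterated Newton–Leibniz with polynomial/rational primitives down to
dimension 0 on each side (values 2/5040 both) and back. Exercises exactly the
disc-fibre/product/min-cell bookkeeping of the big bodies. [difficulty: provable-now] -/
@[route_item "route-KontsevichZagierPeriods-SpectrahedralScissors"]
def XStates25 : Prop :=
  ∀ (r r' : Literature.NumberTheory.Transcendental.KZ.IntegralRep 7), r.domain = {y | (0 ≤ y 0 ∧ 0 ≤ y 1 ∧ 0 ≤ y 2 ∧ 0 ≤ 1 - y 0 - y 1 - y 2 ∧ y 3 ^ 2 + y 4 ^ 2 ≤ y 0 * (1 - y 0 - y 1 - y 2) ∧ y 5 ^ 2 + y 6 ^ 2 ≤ y 1 * y 2) ∧ (y 3 ^ 2 + y 4 ^ 2 ≤ y 1 * y 2 ∧ y 5 ^ 2 + y 6 ^ 2 ≤ y 0 * (1 - y 0 - y 1 - y 2))} → Set.EqOn r.integrand (fun _ => 5) r.domain → r'.domain = {y | 0 ≤ y 0 ∧ 0 ≤ y 1 ∧ 0 ≤ y 2 ∧ 0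 ≤ 1 - y 0 - y 1 - y 2 ∧ y 3 ^ 2 + y 4 ^ 2 ≤ y 0 * (1 - y 0 - y 1 - y 2) ∧ y 5 ^ 2 + y 6 ^ 2 ≤ y 1 * y 2} → Set.EqOn r'.integrand (fun _ => 2) r'.domain → Literature.NumberTheory.Transcendental.KZ.Equivalent r r'

/-- item stmt-KontsevichZagierPeriods-9272 · assembly · rank 1 · closed · proved by Summit.KontsevichZagierPeriods.SpectrahedralScissors.assembly_proof @ e213f3364e39 (prover) · by planner
sources: KontsevichZagier2001, LovasAndai2017, HuongKhoi2024
[assembly] QubitCore833 → RebitCore2964 → Transport → SeparabilityKernel → KontsevichZagierPeriods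
(the type of `closes`). -/
@[route_item "route-KontsevichZagierPeriods-SpectrahedralScissors"]
def Assembly : Prop :=
  QubitCore833 → RebitCore2964 → Transport → SeparabilityKernel → KontsevichZagierPeriods

/-! D-0027 §2.1 — DECIDING THEOREM (planner-authored via `route open/edit --closes-file`; by planner-plancard-KontsevichZagierPeriods-Kont-a2532eab-0 2026-08-15T13:54:52Z):
its hypotheses are this route's items and its conclusion the sub-problem Statement (glue_lint), and it elaborates with this file. -/

/-- Route glue (D-0027 §2.1): the fibre instances and the transport put the two separability relators
inside `KZ.relations`; the enlarged kernel statement then gives `ker eval ≤ relations`, i.e. the kernel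
form, and value equality of two representations is `eval ([r] − [r']) = 0`. -/
@[closes "route-KontsevichZagierPeriods-SpectrahedralScissors"] theorem closes : QubitCore833 → RebitCore2964 → Transport → SeparabilityKernel → KontsevichZagierPeriods := by
  intro hQ hR hT hK n m r r' _ _ hv
  have hS := hT hQ hR
  have h0 : Literature.NumberTheory.Transcendental.KZ.eval (Literature.NumberTheory.Transcendental.KZ.of r - Literature.NumberTheory.Transcendental.KZ.of r') = 0 := by
    simp [Literature.NumberTheory.Transcendental.KZ.eval_of, hv]
  have hmem := hK _ h0
  refine (AddSubgroup.closure_le _).mpr ?_ hmem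
  rintro c ((((hc | hc) | hc) | hc) | (hc | hc))
  · exact Literature.NumberTheory.Transcendental.KZ.domainAddRel_subset_relations hc
  · exact Literature.NumberTheory.Transcendental.KZ.integrandAddRel_subset_relations hc
  · exact Literature.NumberTheory.Transcendental.KZ.changeOfVariablesRel_subset_relations hc
  · exact Literature.NumberTheory.Transcendental.KZ.newtonLeibnizRel_subset_relations hc
  · obtain ⟨ρ, ρ', s, s', hρ, hρ', hd, hi, hd', hi', rfl⟩ := hc
    exact hS.1 ρ ρ' hρ hρ' s s' hd hi hd' hi'
  · obtain ⟨ρ, ρ', s, s', hρ, hρ', hd, hi, hd', hi', rfl⟩ := hc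
    exact hS.2 ρ ρ' hρ hρ' s s' hd hi hd' hi'

end Summit.KontsevichZagierPeriods.KontsevichZagierPeriods.Theses.SpectrahedralScissors
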